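import Summits.AtomisticToContinuum.BoseEinsteinCondensation.Theses.BECInsertionCorrector
import Summits.AtomisticToContinuum.BoseEinsteinCondensation.Theorems.StaticResponseBound.Negative.Basic
import Literature.MathematicalPhysics.QuantumManyBody.WeightedCorrector
import Literature.MathematicalPhysics.QuantumManyBody.LangevinGenerator
import Literature.MathematicalPhysics.QuantumManyBody.PeriodicBoseGasScatteringODE
import HarnessLib

/-!
# The free completed square for the static response bound

Stub `stub_freeSquare` of line `uv-thomson-force-wave` of crux
`BECInsertionCorrector.StaticResponseBound` (item stmt-AtomisticToContinuum-12057; this file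
supports, does not close, the item).

We prove the `v`-independent, kinetic-only form of the static response bound: for every pair
potential `v`, every particle number `N`, every side `L > 0`, every wave vector `k ≠ 0`, every
coupling `t` and every finite-energy periodic trial state `Ψ`,

  `-(N t² / |p|²) ≤ E_v(Ψ) + t ⟨∑ⱼ cos(p·xⱼ)⟩_Ψ`,   `p = 2πk/L`, `|p|² = psq L k`.

Proof: complete the square particle by particle and axis by axis. Put `F = |Ψ|²` and
`θⱼ(X) = p·xⱼ` (a continuous linear functional of the configuration `X`). For a particle `j` and
an axis `c` the flux `G = sin θⱼ · F` is `C¹` and `Lℤ³`-periodic in every particle, with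
`∂_{j,c} G = p_c cos θⱼ F + sin θⱼ ∂_{j,c} F`, so integration by parts on the torus
(`integral_cellN_pderiv_eq_zero`) gives `∫ (p_c cos θⱼ F + sin θⱼ ∂_{j,c}F) = 0`. The derivative of
the squared norm in the real inner product space `ℂ` gives `|∂_{j,c}F| ≤ 2|Ψ| |∂_{j,c}Ψ|`, and
`2ab ≤ a² + b²` then yields, pointwise, with `u = t p_c/|p|²`,
`0 ≤ |∂_{j,c}Ψ|² + u² F - u sin θⱼ ∂_{j,c}F`; adding `u · (p_c cos θⱼ F + sin θⱼ ∂_{j,c}F)` (zero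
integral) and integrating (`∫ F = 1`):
`0 ≤ (t p_c²/|p|²) ∫ cos θⱼ F + ∫ |∂_{j,c}Ψ|² + t² p_c²/|p|⁴`.
Summing over `c` (`∑_c p_c² = |p|²`) and over `j`, and bounding the kinetic energy `∫ |∇Ψ|²` by
`E_v(Ψ)` (the interaction is nonnegative) gives the claim. No smallness and no `v`-dependence;
`k ≠ 0` enters only through `|p|² > 0`.

All ingredients are folklore torus calculus (the `Q ≡ 0` case of Thomson's principle for the
`H₋₁` norm of a density wave).
-/

noncomputable section

namespace Summit.AtomisticToContinuum.BoseEinsteinCondensation.Cruxes.StaticResponseBound.UvThomsonForceWave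

open MeasureTheory Filter
open scoped ENNReal NNReal BigOperators RealInnerProductSpace
open Literature.MathematicalPhysics.QuantumManyBody.BoseGas
open Summit.AtomisticToContinuum.BoseEinsteinCondensation.Theses.BECInsertionCorrector
open Summit.AtomisticToContinuum.BoseEinsteinCondensation.Theorems.StaticResponseBound.Negative

variable {N : ℕ}

/-! ## Elementary facts on `|p|²` and on the phase `θⱼ` -/

/-- `|p|² = ∑_c p_c²` with `p_c = 2πk_c/L`. [folklore] -/
theorem freeSq_psq_eq_sum (L : ℝ) (k : Fin 3 → ℤ) :
    psq L k = ∑ c, (2 * Real.pi / L * (k c : ℝ)) ^ 2 := by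
  unfold psq
  rw [Finset.mul_sum]
  exact Finset.sum_congr rfl fun c _ => by ring

/-- `|p|² > 0` for `k ≠ 0` and `L > 0`. [folklore] -/
theorem freeSq_psq_pos {L : ℝ} (hL : 0 < L) {k : Fin 3 → ℤ} (hk : k ≠ 0) : 0 < psq L k := by
  obtain ⟨i, hi⟩ : ∃ i, k i ≠ 0 := by
    by_contra h
    push Not at h
    exact hk (funext h)
  have hi' : (0 : ℝ) < (2 * Real.pi / L * (k i : ℝ)) ^ 2 := by
    have : (k i : ℝ) ≠ 0 := by exact_mod_cast hi
    positivity
  rw [freeSq_psq_eq_sum]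
  exact lt_of_lt_of_le hi' (Finset.single_le_sum (f := fun c => (2 * Real.pi / L * (k c : ℝ)) ^ 2)
    (fun c _ => sq_nonneg _) (Finset.mem_univ i))

/-- The phase `θⱼ(X) = (2π/L) ∑ᵢ kᵢ x_{j,i}` is a continuous linear functional of the
configuration `X ∈ (ℝ³)^N`. [folklore] -/
theorem freeSq_phase_clm (L : ℝ) (k : Fin 3 → ℤ) (j : Fin N) :
    ∃ Θ : Config N →L[ℝ] ℝ, ∀ X, Θ X = 2 * Real.pi / L * ∑ i, (k i : ℝ) * X j i :=
  ⟨(2 * Real.pi / L) • ∑ i : Fin 3, (k i : ℝ) •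
      ((PiLp.proj (𝕜 := ℝ) 2 (fun _ : Fin 3 => ℝ) i).comp
        (ContinuousLinearMap.proj (R := ℝ) (φ := fun _ : Fin N => Space) j)),
    fun X => by simp [Finset.mul_sum]⟩

/-- Chain rule: `∂_{j,c} sin(Θ ·) = Θ(e_{j,c}) cos(Θ ·)` for a continuous linear functional `Θ`.
[folklore] -/
theorem freeSq_pderiv_sin_clm (Θ : Config N →L[ℝ] ℝ) (j : Fin N) (c : Fin 3) (X : Config N) :
    pderiv j c (fun Y => Real.sin (Θ Y)) X =
      Θ (Pi.single j (EuclideanSpace.single c 1)) * Real.cos (Θ X) := by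
  have hd : HasFDerivAt (fun Y => Real.sin (Θ Y)) (Real.cos (Θ X) • Θ) X :=
    (Real.hasDerivAt_sin (Θ X)).comp_hasFDerivAt X Θ.hasFDerivAt
  rw [pderiv, hd.fderiv, _root_.smul_apply, smul_eq_mul, mul_comm]

/-- Derivative of the squared norm in the real inner product space `ℂ`:
`|∂_{j,c}|ψ|²| = |2 Re⟨ψ, ∂_{j,c}ψ⟩| ≤ 2 |ψ| |∂_{j,c}ψ|` for a differentiable `ψ : (ℝ³)^N → ℂ`.
[folklore] -/
theorem freeSq_abs_pderiv_norm_sq_le {ψ : Config N → ℂ} (hψ : Differentiable ℝ ψ) (j : Fin N)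
    (c : Fin 3) (X : Config N) :
    |pderiv j c (fun Y => ‖ψ Y‖ ^ 2) X| ≤
      2 * ‖ψ X‖ * ‖fderiv ℝ ψ X (Pi.single j (EuclideanSpace.single c 1))‖ := by
  have h := (hψ X).hasFDerivAt.norm_sq
  have h2 : pderiv j c (fun Y => ‖ψ Y‖ ^ 2) X =
      2 * ⟪ψ X, fderiv ℝ ψ X (Pi.single j (EuclideanSpace.single c 1))⟫ := by
    rw [pderiv, h.fderiv]
    simp [two_smul, two_mul]
  rw [h2, abs_mul, abs_two, mul_assoc]
  exact mul_le_mul_of_nonneg_left (abs_real_inner_le_norm _ _) zero_le_two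

/-! ## The completed square for one particle and one axis -/

/-- The completed square for particle `j` and axis `c`: with `p = p_c = 2πk_c/L`, `θ = θⱼ`,
`F = |Ψ|²` and any real `P`, `t`,
`0 ≤ (t p²/P) ∫ cos θ F + ∫ |∂_{j,c}Ψ|² + t² p²/P²`
(torus integration by parts of the flux `sin θ · F`, `|∂F| ≤ 2|Ψ||∂Ψ|`, and `2ab ≤ a² + b²`).
[folklore] -/
theorem freeSq_axis {L : ℝ} (hL : 0 < L) {k : Fin 3 → ℤ} (Ψ : PeriodicTrialState N L)
    {j : Fin N} {c : Fin 3} {θ F : Config N → ℝ} {p : ℝ}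
    (hθ : ∀ X, θ X = 2 * Real.pi / L * ∑ i, (k i : ℝ) * X j i) (hF : ∀ X, F X = ‖Ψ.ψ X‖ ^ 2)
    (hp : p = 2 * Real.pi / L * k c) (P t : ℝ) :
    0 ≤ t * p ^ 2 / P * (∫ X in cellN N L, Real.cos (θ X) * F X)
        + (∫ X in cellN N L, ‖fderiv ℝ Ψ.ψ X (Pi.single j (EuclideanSpace.single c 1))‖ ^ 2)
        + t ^ 2 * p ^ 2 / P ^ 2 := by
  -- the phase is a continuous linear functional
  obtain ⟨Θ, hΘ⟩ := freeSq_phase_clm (N := N) L k j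
  have hθΘ : θ = ⇑Θ := funext fun X => by rw [hθ, hΘ]
  subst hθΘ
  have hL0 : L ≠ 0 := hL.ne'
  -- regularity
  have hψ1 : ContDiff ℝ 1 Ψ.ψ := Ψ.contDiff
  have hψd : Differentiable ℝ Ψ.ψ := hψ1.differentiable one_ne_zero
  have hFeq : F = fun X => ‖Ψ.ψ X‖ ^ 2 := funext hF
  have hF1 : ContDiff ℝ 1 F := by rw [hFeq]; exact hψ1.norm_sq ℂ
  have hFd : Differentiable ℝ F := hF1.differentiable one_ne_zero
  have hS1 : ContDiff ℝ 1 fun X => Real.sin (Θ X) := Real.contDiff_sin.comp Θ.contDiff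
  have hcf : Continuous (fderiv ℝ Ψ.ψ) := hψ1.continuous_fderiv one_ne_zero
  have hFc : Continuous F := hF1.continuous
  have hdFc : Continuous (pderiv j c F) := continuous_pderiv hF1 j c
  have hΘc : Continuous Θ := Θ.continuous
  have hac : Continuous fun X => ‖fderiv ℝ Ψ.ψ X (Pi.single j (EuclideanSpace.single c 1))‖ :=
    (hcf.clm_apply continuous_const).norm
  -- the flux `G = sin θ · F` is `C¹` and lattice periodic
  have hG1 : ContDiff ℝ 1 fun X => Real.sin (Θ X) * F X := hS1.mul hF1
  have hGper : IsLatticePeriodic L fun X => Real.sin (Θ X) * F X := by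
    intro X j' c'
    obtain ⟨m, hm⟩ :
        ∃ m : ℤ, Θ (Pi.single j' (EuclideanSpace.single c' L)) = m * (2 * Real.pi) := by
      rcases eq_or_ne j' j with rfl | hne
      · refine ⟨k c', ?_⟩
        rw [hΘ]
        simp only [Pi.single_eq_same, PiLp.single_apply, mul_ite, mul_zero, Finset.sum_ite_eq',
          Finset.mem_univ, if_true]
        field_simp
      · refine ⟨0, ?_⟩
        rw [hΘ, Pi.single_eq_of_ne' hne]
        simp
    dsimp only
    rw [hF, hF, Ψ.periodic, map_add, hm, Real.sin_add_int_mul_two_pi]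
  -- integration by parts on the torus: `∫ ∂_{j,c} G = 0`, `∂_{j,c} G = p cos θ F + sin θ ∂_{j,c} F`
  have hIBP := integral_cellN_pderiv_eq_zero hL hG1 hGper j c
  have hΘe : Θ (Pi.single j (EuclideanSpace.single c 1)) = p := by
    rw [hΘ, hp]
    simp only [Pi.single_eq_same, PiLp.single_apply, mul_ite, mul_one, mul_zero,
      Finset.sum_ite_eq', Finset.mem_univ, if_true]
  have hderiv : ∀ X, pderiv j c (fun Y => Real.sin (Θ Y) * F Y) X =
      p * Real.cos (Θ X) * F X + Real.sin (Θ X) * pderiv j c F X := by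
    intro X
    rw [pderiv_fun_mul (hS1.differentiable one_ne_zero X) (hFd X), freeSq_pderiv_sin_clm, hΘe]
    ring
  simp_rw [hderiv] at hIBP
  -- the pointwise completed square
  set u : ℝ := t * p / P with hu
  have hpt : ∀ X, 0 ≤ ‖fderiv ℝ Ψ.ψ X (Pi.single j (EuclideanSpace.single c 1))‖ ^ 2
      + u ^ 2 * F X - u * (Real.sin (Θ X) * pderiv j c F X) := by
    intro X
    have h1 : |u * (Real.sin (Θ X) * pderiv j c F X)| ≤
        |u| * (2 * ‖Ψ.ψ X‖ * ‖fderiv ℝ Ψ.ψ X (Pi.single j (EuclideanSpace.single c 1))‖) := by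
      rw [abs_mul, abs_mul]
      refine mul_le_mul_of_nonneg_left ?_ (abs_nonneg u)
      calc |Real.sin (Θ X)| * |pderiv j c F X|
          ≤ 1 * (2 * ‖Ψ.ψ X‖ * ‖fderiv ℝ Ψ.ψ X (Pi.single j (EuclideanSpace.single c 1))‖) :=
            mul_le_mul (Real.abs_sin_le_one _) (hFeq ▸ freeSq_abs_pderiv_norm_sq_le hψd j c X)
              (abs_nonneg _) zero_le_one
        _ = _ := one_mul _
    have h2 := le_abs_self (u * (Real.sin (Θ X) * pderiv j c F X))
    rw [hF X, ← sq_abs u]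
    nlinarith [norm_nonneg (Ψ.ψ X), abs_nonneg u,
      sq_nonneg (‖fderiv ℝ Ψ.ψ X (Pi.single j (EuclideanSpace.single c 1))‖ - |u| * ‖Ψ.ψ X‖)]
  -- integrand = (completed square) + u · (divergence)
  have hsplit : ∀ X, t * p ^ 2 / P * (Real.cos (Θ X) * F X)
      + ‖fderiv ℝ Ψ.ψ X (Pi.single j (EuclideanSpace.single c 1))‖ ^ 2
      + t ^ 2 * p ^ 2 / P ^ 2 * F X =
      (‖fderiv ℝ Ψ.ψ X (Pi.single j (EuclideanSpace.single c 1))‖ ^ 2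
        + u ^ 2 * F X - u * (Real.sin (Θ X) * pderiv j c F X))
      + u * (p * Real.cos (Θ X) * F X + Real.sin (Θ X) * pderiv j c F X) := by
    intro X; rw [hu]; ring
  -- integrability of everything in sight (continuous functions on the bounded cell)
  have hi1 : Integrable (fun X => Real.cos (Θ X) * F X) (volume.restrict (cellN N L)) :=
    integrableOn_cellN (by fun_prop) L
  have hi2 : Integrable (fun X => ‖fderiv ℝ Ψ.ψ X (Pi.single j (EuclideanSpace.single c 1))‖ ^ 2)
      (volume.restrict (cellN N L)) := integrableOn_cellN (hac.pow 2) L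
  have hi3 : Integrable F (volume.restrict (cellN N L)) := integrableOn_cellN hFc L
  have hiA : Integrable (fun X => ‖fderiv ℝ Ψ.ψ X (Pi.single j (EuclideanSpace.single c 1))‖ ^ 2
      + u ^ 2 * F X - u * (Real.sin (Θ X) * pderiv j c F X)) (volume.restrict (cellN N L)) :=
    integrableOn_cellN (by fun_prop) L
  have hiB : Integrable (fun X => p * Real.cos (Θ X) * F X + Real.sin (Θ X) * pderiv j c F X)
      (volume.restrict (cellN N L)) := integrableOn_cellN (by fun_prop) L
  have hF1int : ∫ X in cellN N L, F X = 1 := by rw [hFeq]; exact integral_norm_sq_eq_one Ψ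
  -- assemble
  have key : t * p ^ 2 / P * (∫ X in cellN N L, Real.cos (Θ X) * F X)
      + (∫ X in cellN N L, ‖fderiv ℝ Ψ.ψ X (Pi.single j (EuclideanSpace.single c 1))‖ ^ 2)
      + t ^ 2 * p ^ 2 / P ^ 2 =
      ∫ X in cellN N L, (‖fderiv ℝ Ψ.ψ X (Pi.single j (EuclideanSpace.single c 1))‖ ^ 2
        + u ^ 2 * F X - u * (Real.sin (Θ X) * pderiv j c F X)) := by
    calc t * p ^ 2 / P * (∫ X in cellN N L, Real.cos (Θ X) * F X)
          + (∫ X in cellN N L, ‖fderiv ℝ Ψ.ψ X (Pi.single j (EuclideanSpace.single c 1))‖ ^ 2)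
          + t ^ 2 * p ^ 2 / P ^ 2
        = t * p ^ 2 / P * (∫ X in cellN N L, Real.cos (Θ X) * F X)
          + (∫ X in cellN N L, ‖fderiv ℝ Ψ.ψ X (Pi.single j (EuclideanSpace.single c 1))‖ ^ 2)
          + t ^ 2 * p ^ 2 / P ^ 2 * ∫ X in cellN N L, F X := by rw [hF1int, mul_one]
      _ = ∫ X in cellN N L, (t * p ^ 2 / P * (Real.cos (Θ X) * F X)
          + ‖fderiv ℝ Ψ.ψ X (Pi.single j (EuclideanSpace.single c 1))‖ ^ 2
          + t ^ 2 * p ^ 2 / P ^ 2 * F X) := by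
          have hi12 : Integrable (fun X => t * p ^ 2 / P * (Real.cos (Θ X) * F X)
              + ‖fderiv ℝ Ψ.ψ X (Pi.single j (EuclideanSpace.single c 1))‖ ^ 2)
              (volume.restrict (cellN N L)) := (hi1.const_mul _).add hi2
          rw [← integral_const_mul, ← integral_const_mul, ← integral_add (hi1.const_mul _) hi2,
            ← integral_add hi12 (hi3.const_mul _)]
      _ = ∫ X in cellN N L, ((‖fderiv ℝ Ψ.ψ X (Pi.single j (EuclideanSpace.single c 1))‖ ^ 2
          + u ^ 2 * F X - u * (Real.sin (Θ X) * pderiv j c F X))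
          + u * (p * Real.cos (Θ X) * F X + Real.sin (Θ X) * pderiv j c F X)) :=
          integral_congr_ae (Eventually.of_forall hsplit)
      _ = (∫ X in cellN N L, (‖fderiv ℝ Ψ.ψ X (Pi.single j (EuclideanSpace.single c 1))‖ ^ 2
          + u ^ 2 * F X - u * (Real.sin (Θ X) * pderiv j c F X)))
          + u * ∫ X in cellN N L, (p * Real.cos (Θ X) * F X + Real.sin (Θ X) * pderiv j c F X) := by
          rw [integral_add hiA (hiB.const_mul u), integral_const_mul]
      _ = _ := by rw [hIBP, mul_zero, add_zero]
  rw [key]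
  exact integral_nonneg hpt

/-! ## The stub -/

/-- **The free completed square** (stub S6 of line `uv-thomson-force-wave`, verbatim `FreeSquare`):
for every pair potential `v`, every `N`, `L > 0`, `k ≠ 0`, `t` and every finite-energy periodic trial
state `Ψ`, `-(N t²/|p|²) ≤ E_v(Ψ) + t ⟨∑ⱼ cos(p·xⱼ)⟩_Ψ` with `|p|² = psq L k`: the kinetic energy
alone pays for the linear response to a density wave, uniformly in the interaction (sum over
particles and axes of `freeSq_axis` with `P = |p|²`, `∑_c p_c² = |p|²`, and `∫ |∇Ψ|² ≤ E_v(Ψ)`).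
[folklore] -/
theorem stub_freeSquare :
    ∀ (v : ℝ → ℝ≥0∞) (N : ℕ) (L : ℝ), 0 < L → ∀ (k : Fin 3 → ℤ), k ≠ 0 →
      ∀ (t : ℝ) (Ψ : PeriodicTrialState N L), periodicEnergy v Ψ ≠ ⊤ →
        -((N : ℝ) * t ^ 2 / psq L k) ≤ (periodicEnergy v Ψ).toReal + t * cosMean L k Ψ := by
  intro v N L hL k hk t Ψ hE
  -- opaque names for the phases `θ j`, the density `F = |Ψ|²` and the momenta `p c`
  obtain ⟨θ, hθ⟩ : ∃ θ : Fin N → Config N → ℝ,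
      ∀ j X, θ j X = 2 * Real.pi / L * ∑ i, (k i : ℝ) * X j i := ⟨_, fun _ _ => rfl⟩
  obtain ⟨F, hF⟩ : ∃ F : Config N → ℝ, ∀ X, F X = ‖Ψ.ψ X‖ ^ 2 := ⟨_, fun _ => rfl⟩
  obtain ⟨p, hp⟩ : ∃ p : Fin 3 → ℝ, ∀ c, p c = 2 * Real.pi / L * k c := ⟨_, fun _ => rfl⟩
  have hP : 0 < psq L k := freeSq_psq_pos hL hk
  have hPsum : psq L k = ∑ c, p c ^ 2 := by
    rw [freeSq_psq_eq_sum]; exact Finset.sum_congr rfl fun c _ => by rw [hp]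
  -- regularity and integrability
  have hψ1 : ContDiff ℝ 1 Ψ.ψ := Ψ.contDiff
  have hcf : Continuous (fderiv ℝ Ψ.ψ) := hψ1.continuous_fderiv one_ne_zero
  have hFc : Continuous F := by rw [funext hF]; exact (hψ1.continuous.norm).pow 2
  have hθc : ∀ j, Continuous (θ j) := fun j => by rw [funext (hθ j)]; fun_prop
  have hIcos : ∀ j, Integrable (fun X => Real.cos (θ j X) * F X) (volume.restrict (cellN N L)) :=
    fun j => integrableOn_cellN ((Real.continuous_cos.comp (hθc j)).mul hFc) L
  have hIa : ∀ j c, Integrable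
      (fun X => ‖fderiv ℝ Ψ.ψ X (Pi.single j (EuclideanSpace.single c 1))‖ ^ 2)
      (volume.restrict (cellN N L)) :=
    fun j c => integrableOn_cellN ((hcf.clm_apply continuous_const).norm.pow 2) L
  -- (1) the completed square, per particle and axis, summed over the axes ...
  have hj : ∀ j, 0 ≤ t * (∫ X in cellN N L, Real.cos (θ j X) * F X)
      + (∑ c, ∫ X in cellN N L, ‖fderiv ℝ Ψ.ψ X (Pi.single j (EuclideanSpace.single c 1))‖ ^ 2)
      + t ^ 2 / psq L k := by
    intro j
    have h := Finset.sum_nonneg fun c (_ : c ∈ Finset.univ) =>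
      freeSq_axis hL Ψ (hθ j) hF (hp c) (psq L k) t
    have e1 : ∑ c, t * p c ^ 2 / psq L k * (∫ X in cellN N L, Real.cos (θ j X) * F X) =
        t * ∫ X in cellN N L, Real.cos (θ j X) * F X := by
      rw [← Finset.sum_mul, ← Finset.sum_div, ← Finset.mul_sum, ← hPsum]
      field_simp
    have e2 : ∑ c, t ^ 2 * p c ^ 2 / psq L k ^ 2 = t ^ 2 / psq L k := by
      rw [← Finset.sum_div, ← Finset.mul_sum, ← hPsum]
      field_simp
    rwa [Finset.sum_add_distrib, Finset.sum_add_distrib, e1, e2] at h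
  -- ... and over the particles
  have hsum : 0 ≤ t * (∑ j, ∫ X in cellN N L, Real.cos (θ j X) * F X)
      + (∑ j, ∑ c, ∫ X in cellN N L, ‖fderiv ℝ Ψ.ψ X (Pi.single j (EuclideanSpace.single c 1))‖ ^ 2)
      + N * (t ^ 2 / psq L k) := by
    have h := Finset.sum_nonneg fun j (_ : j ∈ Finset.univ) => hj j
    rwa [Finset.sum_add_distrib, Finset.sum_add_distrib, ← Finset.mul_sum, Finset.sum_const,
      Finset.card_univ, Fintype.card_fin, nsmul_eq_mul] at h
  -- (2) the first sum is `⟨∑ⱼ cos(p·xⱼ)⟩_Ψ`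
  have hcm : cosMean L k Ψ = ∑ j, ∫ X in cellN N L, Real.cos (θ j X) * F X := by
    rw [← integral_finsetSum _ fun j _ => hIcos j]
    simp only [cosMean, hθ, hF, Finset.sum_mul]
  -- (3) the second sum is the kinetic energy, bounded by the total energy
  have hKsum : ∑ j, ∑ c, ∫ X in cellN N L,
        ‖fderiv ℝ Ψ.ψ X (Pi.single j (EuclideanSpace.single c 1))‖ ^ 2 =
      ∫ X in cellN N L, ∑ j, ∑ c,
        ‖fderiv ℝ Ψ.ψ X (Pi.single j (EuclideanSpace.single c 1))‖ ^ 2 := by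
    rw [integral_finsetSum _ fun j _ => integrable_finsetSum _ fun c _ => hIa j c]
    exact Finset.sum_congr rfl fun j _ => (integral_finsetSum _ fun c _ => hIa j c).symm
  have hKin : ∫ X in cellN N L, ∑ j, ∑ c,
        ‖fderiv ℝ Ψ.ψ X (Pi.single j (EuclideanSpace.single c 1))‖ ^ 2 ≤
      (periodicEnergy v Ψ).toReal := by
    have hint : Integrable
        (fun X => ∑ j, ∑ c, ‖fderiv ℝ Ψ.ψ X (Pi.single j (EuclideanSpace.single c 1))‖ ^ 2)
        (volume.restrict (cellN N L)) :=
      integrable_finsetSum _ fun j _ => integrable_finsetSum _ fun c _ => hIa j c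
    have hpt : ∀ X, ENNReal.ofReal
        (∑ j, ∑ c, ‖fderiv ℝ Ψ.ψ X (Pi.single j (EuclideanSpace.single c 1))‖ ^ 2) =
        kineticDensity Ψ.ψ X := by
      intro X
      rw [kineticDensity, ENNReal.ofReal_sum_of_nonneg fun j _ =>
        Finset.sum_nonneg fun c _ => sq_nonneg _]
      refine Finset.sum_congr rfl fun j _ => ?_
      rw [ENNReal.ofReal_sum_of_nonneg fun c _ => sq_nonneg _]
      exact Finset.sum_congr rfl fun c _ => (coe_nnnorm_sq_eq_ofReal _).symm
    rw [integral_eq_lintegral_of_nonneg_ae (Eventually.of_forall fun X => Finset.sum_nonneg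
      fun j _ => Finset.sum_nonneg fun c _ => sq_nonneg _) hint.aestronglyMeasurable]
    refine ENNReal.toReal_mono hE ?_
    calc ∫⁻ X in cellN N L, ENNReal.ofReal
          (∑ j, ∑ c, ‖fderiv ℝ Ψ.ψ X (Pi.single j (EuclideanSpace.single c 1))‖ ^ 2)
        = ∫⁻ X in cellN N L, kineticDensity Ψ.ψ X := lintegral_congr fun X => hpt X
      _ ≤ periodicEnergy v Ψ := lintegral_mono fun X => le_self_add
  -- (4) conclude
  rw [hcm]
  rw [hKsum] at hsum
  have e3 : (N : ℝ) * t ^ 2 / psq L k = N * (t ^ 2 / psq L k) := by ring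
  rw [e3]
  linarith

end Summit.AtomisticToContinuum.BoseEinsteinCondensation.Cruxes.StaticResponseBound.UvThomsonForceWave

end
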